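import Summits.CriticalPhenomena.PercolationContinuityZ3.Theorems.PercNearOneGluingNoHeavyLowerTailSahiCombDisjunctThreeComb
import Summits.CriticalPhenomena.PercolationContinuityZ3.Theorems.PercNearOneGluingNoHeavyLowerTailSahiCombRange
import Literature.Combinatorics.Sahi2008.Multilinear

/-!
# The comb (tensor-Bernstein) hierarchy for Sahi's `E_k`, XXIII: DISJUNCTIVE CLOSURE AT EVERY ORDER (typed) — its order-3 case is a
# theorem, and the full statement implies comb positivity of EVERY family of OR-events at EVERY order

Support file of the one-cut programme (crux `NoHeavyLowerTail`, stmt-CriticalPhenomena-4575; cell `prim-masterthm`, seat P3, gen 5;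
`run/shared/lean/prim/prim-masterthm/prim-masterthm-p3/HIERARCHY.md` §12).  Vocabulary: `SahiComb.CombPos` (`…SahiCombPositivity`), the order-3
disjunctive closure `SahiCombDisjunct.combPos_sahiE_three_unionCoord` (`…SahiCombDisjunctThreeComb`), range lifting over three events
`SahiCombRange.combPos_sahiE_ind_iff_of_three` (`…SahiCombRange`).

* `CombAllOrders U` — the family `U : Fin n → Set (Set ι)` of events of a finite cube is comb-positive at EVERY order: for every multiset of
  members `s : Fin m → Fin n`, `p ↦ E_m(μ_p; 1_{U_{s 0}},…,1_{U_{s (m−1)}})` is `CombPos` at multidegree `m`.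
* **`CombDisjunctiveClosure`** (`@[conjecture]`, this seat; the comb-level / product-measure form of the MIXTURE CONJECTURE of `…SahiMixtureLaw`):
  if `U` is a family of increasing events ignoring the coordinate `e` with `CombAllOrders U`, then OR-ing the coordinate event `{e ∈ ω}` into any
  sub-collection `G` keeps `CombAllOrders`.  THEOREM for `n ≤ 3` members (`combDisjunctiveClosure_three`: gen 4's explicit one-coordinate Bernstein
  pieces + range lifting).  Census (this seat, gen 5, engine `combk`): order 4 on the base cube `{0,1}^3` — all 8 855 multisets of four up-sets
  × 15 non-empty `G`, 132 825 degree-4 comb rows of 625 coefficients each, 0 negative.  At order 4 with `|G| = 2` the middle one-coordinate piece is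
  `E_3(U_0∩U_1,U_2,U_3) + (1 + ½μ(Ū_0Ū_1))·Cov(U_2,U_3) + μ(Ū_0Ū_1U_2U_3)` (gen 4, symbolic), so the closure there follows from (M⁺-3) for the
  derived triple; OPEN in general — never import it as a fact.
* **`combAllOrders_orFamily_of_closure`** — THE REDUCTION: `CombDisjunctiveClosure` implies that EVERY finite family of OR-events
  `{ω | ω ∩ S_i ≠ ∅}` on every finite cube is comb-positive at every order (induction on the coordinates, starting from the empty family whose
  functionals vanish identically) — i.e. conjecture OR(∞) of HIERARCHY §11 (coverage indicators of finite Boolean models are Sahi-positive at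
  every order, with nonnegative tensor-Bernstein coefficients) would follow.  Unconditionally the tree has this for `n ≤ 3` OR-events
  (`SahiCombRange.combPos_sahiE_ind_or_three`) and, at order 4, for quadruples of unions with pairwise sharing (`…SahiCombVennFourPairs`).
HONEST FRAMING: nothing here asserts (M⁺-k) or `C_k` for `k ≥ 3` in general; the closure is a conjecture beyond three members. [this work]
-/

noncomputable section

open scoped Classical

namespace Summit.CriticalPhenomena.PercolationContinuityZ3.Theorems

open Finset Function
open Literature.Combinatorics.Sahi2008
open Literature.Probability.Percolation.DecisionTree (ind ind_of_mem ind_of_not_mem ind_nonneg)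
open SahiComb

namespace SahiCombDisjunct

/-! ### All-orders comb positivity and the closure conjecture -/

/-- The family `U` of events of the cube `2^ι` is **comb-positive at every order**: for every multiset of members `s : Fin m → Fin n`,
`p ↦ E_m(μ_p; 1_{U_{s 0}},…,1_{U_{s (m−1)}})` is a nonnegative combination of the degree-`m` tensor-Bernstein basis. [this work] -/
def CombAllOrders {ι : Type} [Fintype ι] {n : ℕ} (U : Fin n → Set (Set ι)) : Prop :=
  ∀ (m : ℕ) (s : Fin m → Fin n), CombPos (fun _ : ι => m) (fun p => sahiE (bernoulliWeight p) m (fun j => ind (U (s j))))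

/-- OR-ing the coordinate event `{e ∈ ω}` into the members selected by `G`. [this work] -/
def orCoord {ι : Type} {n : ℕ} (U : Fin n → Set (Set ι)) (e : ι) (G : Fin n → Bool) : Fin n → Set (Set ι) :=
  fun j => bif G j then U j ∪ {ω : Set ι | e ∈ ω} else U j

/-- **DISJUNCTIVE CLOSURE AT EVERY ORDER (comb level)** (this seat; the product-measure / comb form of the MIXTURE CONJECTURE,
HIERARCHY.md §11–§12): for every finite cube, every family `U` of increasing events ignoring a coordinate `e` that is comb-positive at every
order, and every `G`, the family `(U_j ∪ [G j]·{e ∈ ω})_j` is comb-positive at every order.  THEOREM for `n ≤ 3` members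
(`combDisjunctiveClosure_three`); exhaustive order-4 census on the 3-cube clean; OPEN in general.  An obligation of our theories, never a fact:
use as `(h : CombDisjunctiveClosure)`. [status: open] -/
@[conjecture] def CombDisjunctiveClosure : Prop :=
  ∀ (ι : Type) [Fintype ι] (n : ℕ) (U : Fin n → Set (Set ι)) (e : ι) (G : Fin n → Bool),
    (∀ j, IsUpperSet (U j)) → (∀ (j : Fin n) (b : Bool), secAt e b (U j) = U j) → CombAllOrders U →
      CombAllOrders (orCoord U e G)

variable {ι : Type} [Fintype ι]

omit [Fintype ι] in
/-- Members of `orCoord U e G` are increasing. [this work] -/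
theorem isUpperSet_orCoord {n : ℕ} {U : Fin n → Set (Set ι)} (hU : ∀ j, IsUpperSet (U j)) (e : ι) (G : Fin n → Bool) (j : Fin n) :
    IsUpperSet (orCoord U e G j) := by
  unfold orCoord
  cases G j
  · exact hU j
  · exact (hU j).union fun _ _ hle he => hle he

/-! ### The order-3 case is a theorem -/

/-- **`CombDisjunctiveClosure` holds for families of at most three members** (`n = 3`; smaller families embed): gen 4's explicit nonnegative
one-coordinate Bernstein pieces give the cubic row of the OR-ed triple (`combPos_sahiE_three_unionCoord`), and over three events the cubic row
carries every order (`SahiCombRange.combPos_sahiE_ind_iff_of_three`). [this work] -/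
theorem combDisjunctiveClosure_three (U : Fin 3 → Set (Set ι)) (e : ι) (G : Fin 3 → Bool) (hU : ∀ j, IsUpperSet (U j))
    (hUe : ∀ (j : Fin 3) (b : Bool), secAt e b (U j) = U j) (hall : CombAllOrders U) : CombAllOrders (orCoord U e G) := by
  have h3 : CombPos (fun _ : ι => 3) (fun p => sahiE (bernoulliWeight p) 3 (fun j => ind (U j))) := hall 3 id
  have hV3 : CombPos (fun _ : ι => 3) (fun p => sahiE (bernoulliWeight p) 3 (fun j => ind (orCoord U e G j))) := by
    refine (combPos_sahiE_three_unionCoord U hU e hUe h3 (fun j => G j = true)).congr fun p => ?_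
    congr 1; funext j
    unfold orCoord
    cases G j <;> simp
  intro m s
  exact (SahiCombRange.combPos_sahiE_ind_iff_of_three (orCoord U e G) (isUpperSet_orCoord hU e G)).2 hV3 m s

/-! ### The reduction: closure ⇒ every OR-family is comb-positive at every order -/

/-- With a zero slot every `E_m` vanishes; in particular the all-`∅` family has `E_m ≡ 0`. [folklore] -/
theorem sahiE_ind_empty_eq_zero (μ : Set ι → ℝ) (m : ℕ) : sahiE μ m (fun _ : Fin m => ind (∅ : Set (Set ι))) = 0 := by
  cases m with
  | zero => exact sahiE_zero _ _
  | succ k =>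
    have e : (fun _ : Fin (k + 1) => ind (∅ : Set (Set ι))) = update (fun _ : Fin (k + 1) => ind (∅ : Set (Set ι))) 0 0 := by
      funext j
      by_cases hj : j = 0
      · subst hj; rw [update_self]; funext ω; exact ind_of_not_mem (by simp)
      · rw [update_of_ne hj]
    rw [e]
    exact sahiE_update_zero μ _ 0

/-- The empty family (every member `∅`) is comb-positive at every order. [this work] -/
theorem combAllOrders_empty (n : ℕ) : CombAllOrders (fun _ : Fin n => (∅ : Set (Set ι))) :=
  fun m _ => (CombPos.zero _).congr fun p => sahiE_ind_empty_eq_zero (bernoulliWeight p) m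

/-- **THE REDUCTION.**  `CombDisjunctiveClosure` implies: for every finite cube and every finite family of OR-events
`B_i = {ω | ω ∩ S_i ≠ ∅}` (`S_i` arbitrary coordinate sets, repetitions and overlaps allowed), the family is comb-positive at EVERY order —
every `E_m(μ_p; 1_{B_{s 0}},…,1_{B_{s (m−1)}})` has nonnegative degree-`m` tensor-Bernstein coefficients (conjecture OR(∞) of HIERARCHY §11).
Induction on the set of activated coordinates from the empty family, one closure step per coordinate. [this work] -/
theorem combAllOrders_orFamily_of_closure (hcl : CombDisjunctiveClosure) (n : ℕ) (S : Fin n → Finset ι) :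
    CombAllOrders (fun i => {ω : Set ι | ∃ a ∈ S i, a ∈ ω}) := by
  classical
  suffices key : ∀ T : Finset ι, CombAllOrders (fun i => {ω : Set ι | ∃ a ∈ S i ∩ T, a ∈ ω}) by
    have h := key Finset.univ
    simp only [Finset.inter_univ] at h
    exact h
  intro T
  induction T using Finset.induction_on with
  | empty =>
    have e : (fun i : Fin n => {ω : Set ι | ∃ a ∈ S i ∩ (∅ : Finset ι), a ∈ ω}) = fun _ => (∅ : Set (Set ι)) := by
      funext i; ext ω; simp
    rw [e]
    exact combAllOrders_empty n
  | insert e T heT ih =>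
    set W : Fin n → Set (Set ι) := fun i => {ω : Set ι | ∃ a ∈ S i ∩ T, a ∈ ω} with hW
    have hWup : ∀ i, IsUpperSet (W i) := fun i => isUpperSet_orEvent _
    have hWe : ∀ (i : Fin n) (b : Bool), secAt e b (W i) = W i := fun i b =>
      secAt_orEvent_of_notMem e (S i ∩ T) (fun h => heT (Finset.mem_inter.1 h).2) b
    have hcl' := hcl ι n W e (fun i => decide (e ∈ S i)) hWup hWe ih
    have e' : orCoord W e (fun i => decide (e ∈ S i)) = fun i => {ω : Set ι | ∃ a ∈ S i ∩ insert e T, a ∈ ω} := by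
      funext i
      unfold orCoord
      ext ω
      by_cases hie : e ∈ S i
      · simp only [hie, decide_true, cond_true, hW, Set.mem_union, Set.mem_setOf_eq, Finset.mem_inter, Finset.mem_insert]
        constructor
        · rintro (⟨a, ⟨haS, haT⟩, haω⟩ | hω)
          · exact ⟨a, ⟨haS, Or.inr haT⟩, haω⟩
          · exact ⟨e, ⟨hie, Or.inl rfl⟩, hω⟩
        · rintro ⟨a, ⟨haS, rfl | haT⟩, haω⟩
          · exact Or.inr haω
          · exact Or.inl ⟨a, ⟨haS, haT⟩, haω⟩
      · simp only [hie, decide_false, cond_false, hW, Set.mem_setOf_eq, Finset.mem_inter, Finset.mem_insert]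
        constructor
        · rintro ⟨a, ⟨haS, haT⟩, haω⟩
          exact ⟨a, ⟨haS, Or.inr haT⟩, haω⟩
        · rintro ⟨a, ⟨haS, rfl | haT⟩, haω⟩
          · exact absurd haS hie
          · exact ⟨a, ⟨haS, haT⟩, haω⟩
    rw [e'] at hcl'
    exact hcl'

/-- Law-level shadow of the reduction: under `CombDisjunctiveClosure`, `E_m(μ_p) ≥ 0` for every multiset of OR-events and every product
measure. [this work] -/
theorem sahiE_orFamily_nonneg_of_closure (hcl : CombDisjunctiveClosure) (n : ℕ) (S : Fin n → Finset ι) (p : ι → unitInterval)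
    (m : ℕ) (s : Fin m → Fin n) :
    0 ≤ sahiE (bernoulliWeight p) m (fun j => ind {ω : Set ι | ∃ a ∈ S (s j), a ∈ ω}) :=
  (combAllOrders_orFamily_of_closure hcl n S m s).nonneg p

/-- Unconditionally: every family of at most three OR-events is comb-positive at every order (restating `SahiCombRange.combPos_sahiE_ind_or_three`
in the vocabulary of this file). [this work] -/
theorem combAllOrders_orFamily_three (S : Fin 3 → Finset ι) : CombAllOrders (fun i => {ω : Set ι | ∃ a ∈ S i, a ∈ ω}) :=
  fun _ s => SahiCombRange.combPos_sahiE_ind_or_three S s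

end SahiCombDisjunct

end Summit.CriticalPhenomena.PercolationContinuityZ3.Theorems

end
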